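import Summits.Ventures.HodgeRepro2.T5SU11ResolventL2Schur

/-!
# The weighted Schur test: the resolvent on `L²(sinh 2t dt)` for every `λ > 1`, with the weight `φ_{λ′}`

Row 547's Schur test used the row sums `∫ |K_λ(t, s)| sinh 2s ds = 1/μ`, which are finite only for `λ > 2`. For every
`λ > 1` the **weighted** Schur test with the spherical weight `p = φ_{λ′}`, `1 < λ′ < λ`, works instead: row 520 gives
`∫_{(0,∞)} |K_λ(t, s)| φ_{λ′}(s) sinh 2s ds = φ_{λ′}(t)/(μ − μ′)` (`μ − μ′ = λ(λ − 2) − λ′(λ′ − 2) > 0`), so for a source `g`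
of the class (rate `ε > 2 − λ`) with **`g² sinh 2s ∈ L¹(0, ∞)`**,

* `integrableOn_abs_sphGreenKernel_mul_sph_snd`, `integral_abs_sphGreenKernel_mul_sph_snd` — the weighted row sums
  `∫_s |K_λ(t, s)| φ_{λ′}(s) sinh 2s ds = φ_{λ′}(t)/(μ − μ′)` (row 520 through the symmetry of the kernel);
* `integrable_prod_kernel_sq_weighted` — `|K_λ(t, s)| (g(s)²/φ_{λ′}(s)) sinh 2s · φ_{λ′}(t) sinh 2t` is integrable on
  `(0, ∞)²`;
* `sq_greenSolI_le_weighted`, `ae_sq_greenSolI_mul_sinh_le_weighted` — **Cauchy–Schwarz with the weight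
  `|K_λ(t, ·)| φ_{λ′} sinh 2s`**: `G^I_λ g(t)² ≤ (φ_{λ′}(t)/(μ − μ′)) ∫_s |K_λ(t, s)| g(s)²/φ_{λ′}(s) sinh 2s ds`;
* `integrableOn_sinh_mul_greenSolI_sq_weighted` — **`sinh 2t · G^I_λ g(t)²` is integrable on `(0, ∞)` for every `λ > 1`**;
* `integral_sinh_mul_greenSolI_sq_le_weighted` — **`∫ sinh 2t (G^I_λ g)² ≤ (∫ sinh 2s g²)/(μ − μ′)²` for every `λ > 1`,
  every `1 < λ′ < λ` and every square-integrable source of the class** — the `L²` operator norm of `(L − μ)⁻¹` is at most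
  `1/(μ − μ′) = 1/dist(μ, μ′)`; as `λ′ → 1⁺` the constant tends to `1/(μ + 1) = 1/(λ − 1)²`, row 532's sharp constant.

Nothing is claimed about (N).

Blind lane: Mathlib + the HodgeRepro2 prefix only; no sorry; axioms ⊆ {propext, Classical.choice,
Quot.sound}.
-/

namespace Summit.Ventures.HodgeRepro2.T5SU11ResolventL2SchurWeighted

open Filter Topology MeasureTheory
open Set (Ioi Ioc)
open T5SU11Cartan T5SU11SphericalFunction T5SU11SphericalDecay T5SU11RadialGreenKernel
  T5SU11RadialGreenImproper T5SU11RadialGreenImproperDecaySource T5SU11RadialGreenImproperStable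
  T5SU11ResolventKernelComposition T5SU11ResolventTransformClass T5SU11RadialGreenPositivity
  T5SU11SphericalContinuous T5SU11SphericalBounds T5SU11ResolventL2Schur

section measure

variable [MeasurableSpace Circle] [BorelSpace Circle]

variable {lam lam' : ℝ} (hlam : 1 < lam) (h1 : 1 < lam') (h2 : lam' < lam)

include hlam h1 h2 in
/-- **The weighted rows of the kernel are integrable**: `s ↦ |K_λ(t, s)| φ_{λ′}(s) sinh 2s` is integrable on `(0, ∞)`
for every `t > 0` (row 520's columns through the symmetry of the kernel). -/
theorem integrableOn_abs_sphGreenKernel_mul_sph_snd {t : ℝ} (ht : 0 < t) :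
    IntegrableOn (fun s => |sphGreenKernel lam t s| * sph lam' (hyp s) * Real.sinh (2 * s)) (Ioi 0) := by
  have hI : IntegrableOn (fun s => |sphGreenKernel lam s t * sph lam' (hyp s) * Real.sinh (2 * s)|) (Ioi 0) :=
    (integrableOn_kernel_mul_sph hlam h1 h2 ht).abs
  refine hI.congr_fun (fun s hs => ?_) measurableSet_Ioi
  have hs0 : 0 < s := hs
  simp only
  rw [abs_mul, abs_mul, abs_of_pos (sph_hyp_pos lam' s),
    abs_of_nonneg (Real.sinh_nonneg_iff.mpr (by linarith : (0 : ℝ) ≤ 2 * s)), sphGreenKernel_symm lam s t]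

include hlam h1 h2 in
/-- **The weighted row sums of the kernel**: `∫_{(0,∞)} |K_λ(t, s)| φ_{λ′}(s) sinh 2s ds = φ_{λ′}(t)/(μ − μ′)` for every
`t > 0`, `1 < λ′ < λ` (row 520 through the symmetry of the kernel). -/
theorem integral_abs_sphGreenKernel_mul_sph_snd {t : ℝ} (ht : 0 < t) :
    ∫ s in Ioi 0, |sphGreenKernel lam t s| * sph lam' (hyp s) * Real.sinh (2 * s)
      = sph lam' (hyp t) / (lam * (lam - 2) - lam' * (lam' - 2)) := by
  rw [← integral_abs_kernel_mul_sph_fst hlam h1 h2 ht]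
  apply setIntegral_congr_fun measurableSet_Ioi
  intro s hs
  have hs0 : 0 < s := hs
  simp only
  rw [abs_mul, abs_mul, abs_of_pos (sph_hyp_pos lam' s),
    abs_of_nonneg (Real.sinh_nonneg_iff.mpr (by linarith : (0 : ℝ) ≤ 2 * s)), sphGreenKernel_symm lam s t]

variable {g : ℝ → ℝ} (hg : ContinuousOn g (Ioi 0))
  {M : ℝ} (hM : ∀ s ∈ Ioc (0 : ℝ) 1, |g s| ≤ M) (hM0 : 0 ≤ M)
  {ε C s₀ : ℝ} (hε : 2 - lam < ε) (hC : ∀ s, s₀ ≤ s → |g s| ≤ C * Real.exp (-ε * s))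
  (hg2 : IntegrableOn (fun s => Real.sinh (2 * s) * g s ^ 2) (Ioi 0))

include hlam h1 h2 hg hg2 in
/-- **The weighted product integrand `|K_λ(t, s)| (g(s)²/φ_{λ′}(s)) sinh 2s · φ_{λ′}(t) sinh 2t` is integrable on
`(0, ∞)²`** for every continuous source with `g² sinh 2s ∈ L¹(0, ∞)`. -/
theorem integrable_prod_kernel_sq_weighted :
    Integrable (Function.uncurry fun t s => |sphGreenKernel lam t s| * (Real.sinh (2 * s) * g s ^ 2 / sph lam' (hyp s))
        * (sph lam' (hyp t) * Real.sinh (2 * t)))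
      ((volume.restrict (Ioi 0)).prod (volume.restrict (Ioi 0))) := by
  have hμ : 0 < lam * (lam - 2) - lam' * (lam' - 2) := by nlinarith
  have hχ : ContinuousOn (sphDecay lam) (Ioi 0) :=
    fun _ hr => (hasDerivAt_sphDecay hlam hr).continuousAt.continuousWithinAt
  -- measurability: the integrand is continuous on the open quadrant (`φ_{λ′} > 0`)
  have hmeas : AEStronglyMeasurable (Function.uncurry fun t s => |sphGreenKernel lam t s|
      * (Real.sinh (2 * s) * g s ^ 2 / sph lam' (hyp s)) * (sph lam' (hyp t) * Real.sinh (2 * t)))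
      ((volume.restrict (Ioi 0)).prod (volume.restrict (Ioi 0))) := by
    rw [Measure.prod_restrict]
    refine ContinuousOn.aestronglyMeasurable ?_ (measurableSet_Ioi.prod measurableSet_Ioi)
    have hK : ContinuousOn (fun p : ℝ × ℝ => sphGreenKernel lam p.1 p.2) (Ioi 0 ×ˢ Ioi 0) := by
      simp only [sphGreenKernel, greenKernel]
      apply ContinuousOn.neg
      apply ContinuousOn.mul
      · exact ((continuous_sph_hyp lam).comp (continuous_fst.min continuous_snd)).continuousOn
      · exact hχ.comp (continuous_fst.max continuous_snd).continuousOn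
          (fun p hp => Set.mem_Ioi.mpr (lt_of_lt_of_le (Set.mem_Ioi.mp hp.1) (le_max_left _ _)))
    have hg' : ContinuousOn (fun p : ℝ × ℝ => g p.2) (Ioi 0 ×ˢ Ioi 0) :=
      hg.comp continuous_snd.continuousOn (fun p hp => hp.2)
    have hφs : ContinuousOn (fun p : ℝ × ℝ => sph lam' (hyp p.2)) (Ioi 0 ×ˢ Ioi 0) :=
      ((continuous_sph_hyp lam').comp continuous_snd).continuousOn
    have hφt : ContinuousOn (fun p : ℝ × ℝ => sph lam' (hyp p.1)) (Ioi 0 ×ˢ Ioi 0) :=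
      ((continuous_sph_hyp lam').comp continuous_fst).continuousOn
    refine (hK.abs.mul (ContinuousOn.div ((Real.continuous_sinh.comp
      (continuous_const.mul continuous_snd)).continuousOn.mul (hg'.pow 2)) hφs
      (fun p _ => (sph_hyp_pos lam' p.2).ne'))).mul
      (hφt.mul (Real.continuous_sinh.comp (continuous_const.mul continuous_fst)).continuousOn)
  rw [integrable_prod_iff' hmeas]
  refine ⟨?_, ?_⟩
  · -- for every `s > 0`, the weighted column `t ↦ |K_λ(t, s)| φ_{λ′}(t) sinh 2t · c(s)` is integrable
    refine (ae_restrict_iff' measurableSet_Ioi).mpr (Eventually.of_forall fun s hs => ?_)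
    have hs0 : 0 < s := hs
    have h : IntegrableOn (fun t => |sphGreenKernel lam t s * sph lam' (hyp t) * Real.sinh (2 * t)|
        * (Real.sinh (2 * s) * g s ^ 2 / sph lam' (hyp s))) (Ioi 0) :=
      (integrableOn_kernel_mul_sph hlam h1 h2 hs0).abs.mul_const (Real.sinh (2 * s) * g s ^ 2 / sph lam' (hyp s))
    refine h.congr_fun (fun t ht => ?_) measurableSet_Ioi
    have ht0 : 0 < t := ht
    simp only [Function.uncurry_apply_pair]
    rw [abs_mul, abs_mul, abs_of_pos (sph_hyp_pos lam' t),
      abs_of_nonneg (Real.sinh_nonneg_iff.mpr (by linarith : (0 : ℝ) ≤ 2 * t))]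
    ring
  · -- the outer function `s ↦ ∫_t ‖F(t, s)‖ dt = g(s)² sinh 2s/(μ − μ′)` is integrable
    have hI := hg2.mul_const (1 / (lam * (lam - 2) - lam' * (lam' - 2)))
    refine hI.congr ?_
    refine (ae_restrict_iff' measurableSet_Ioi).mpr (Eventually.of_forall fun s hs => ?_)
    have hs0 : 0 < s := hs
    have hsinh : 0 ≤ Real.sinh (2 * s) := Real.sinh_nonneg_iff.mpr (by linarith)
    have hφ : 0 < sph lam' (hyp s) := sph_hyp_pos lam' s
    simp only
    have e : ∫ t in Ioi 0, ‖Function.uncurry (fun t s => |sphGreenKernel lam t s|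
        * (Real.sinh (2 * s) * g s ^ 2 / sph lam' (hyp s)) * (sph lam' (hyp t) * Real.sinh (2 * t))) (t, s)‖
        = ∫ t in Ioi 0, |sphGreenKernel lam t s * sph lam' (hyp t) * Real.sinh (2 * t)|
          * (Real.sinh (2 * s) * g s ^ 2 / sph lam' (hyp s)) := by
      apply setIntegral_congr_fun measurableSet_Ioi
      intro t ht
      have ht0 : 0 < t := ht
      have hsinh_t : 0 ≤ Real.sinh (2 * t) := Real.sinh_nonneg_iff.mpr (by linarith)
      have hF0 : 0 ≤ |sphGreenKernel lam t s| * (Real.sinh (2 * s) * g s ^ 2 / sph lam' (hyp s))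
          * (sph lam' (hyp t) * Real.sinh (2 * t)) :=
        mul_nonneg (mul_nonneg (abs_nonneg _) (div_nonneg (mul_nonneg hsinh (sq_nonneg _)) hφ.le))
          (mul_nonneg (sph_hyp_pos lam' t).le hsinh_t)
      simp only [Function.uncurry_apply_pair, Real.norm_eq_abs]
      rw [abs_of_nonneg hF0, abs_mul, abs_mul, abs_of_pos (sph_hyp_pos lam' t), abs_of_nonneg hsinh_t]
      ring
    rw [e, MeasureTheory.integral_mul_const, integral_abs_kernel_mul_sph_fst hlam h1 h2 hs0]
    field_simp

include hlam h1 h2 hg hM hM0 hε hC in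
/-- **Weighted Cauchy–Schwarz on the kernel at one point**: if `s ↦ |K_λ(t, s)| sinh 2s · g(s)²/φ_{λ′}(s)` is
integrable, then `G^I_λ g(t)² ≤ (φ_{λ′}(t)/(μ − μ′)) ∫_s |K_λ(t, s)| sinh 2s · g(s)²/φ_{λ′}(s) ds` (`t > 0`). -/
theorem sq_greenSolI_le_weighted {t : ℝ} (ht : 0 < t)
    (hI : IntegrableOn (fun s => |sphGreenKernel lam t s| * Real.sinh (2 * s) * (g s ^ 2 / sph lam' (hyp s))) (Ioi 0)) :
    greenSolI (fun t => sph lam (hyp t)) (sphDecay lam) g t ^ 2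
      ≤ (sph lam' (hyp t) / (lam * (lam - 2) - lam' * (lam' - 2)))
        * ∫ s in Ioi 0, |sphGreenKernel lam t s| * Real.sinh (2 * s) * (g s ^ 2 / sph lam' (hyp s)) := by
  have hB := integrableOn_sph_mul_mul_sinh_Ioc hg hM hM0 lam
  have hA := integrableOn_sphDecay_mul_mul_sinh hlam hg hM hM0 hε hC
  -- the weight `w(s) = |K_λ(t, s)| φ_{λ′}(s) sinh 2s` (mass `φ_{λ′}(t)/(μ − μ′)`) and `h = −g/φ_{λ′}`: `G^I_λ g(t) = ∫ w h`
  have hw : IntegrableOn (fun s => |sphGreenKernel lam t s| * sph lam' (hyp s) * Real.sinh (2 * s)) (Ioi 0) :=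
    integrableOn_abs_sphGreenKernel_mul_sph_snd hlam h1 h2 ht
  have hwh : IntegrableOn (fun s => |sphGreenKernel lam t s| * sph lam' (hyp s) * Real.sinh (2 * s)
      * (-(g s / sph lam' (hyp s)))) (Ioi 0) := by
    refine (integrableOn_kernel_mul hB hA ht).congr_fun (fun s _ => ?_) measurableSet_Ioi
    have hφ : sph lam' (hyp s) ≠ 0 := (sph_hyp_pos lam' s).ne'
    simp only
    rw [abs_of_neg (sphGreenKernel_neg hlam ht)]
    unfold sphGreenKernel
    field_simp
  have hwh2 : IntegrableOn (fun s => |sphGreenKernel lam t s| * sph lam' (hyp s) * Real.sinh (2 * s)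
      * (-(g s / sph lam' (hyp s))) ^ 2) (Ioi 0) := by
    refine hI.congr_fun (fun s _ => ?_) measurableSet_Ioi
    have hφ : sph lam' (hyp s) ≠ 0 := (sph_hyp_pos lam' s).ne'
    simp only
    field_simp
  have hcs := sq_integral_le_integral_mul_integral_sq measurableSet_Ioi
    (w := fun s => |sphGreenKernel lam t s| * sph lam' (hyp s) * Real.sinh (2 * s))
    (h := fun s => -(g s / sph lam' (hyp s)))
    (fun s hs => mul_nonneg (mul_nonneg (abs_nonneg _) (sph_hyp_pos lam' s).le)
      (Real.sinh_nonneg_iff.mpr (by linarith [Set.mem_Ioi.mp hs]))) hw hwh hwh2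
  have hrep : greenSolI (fun t => sph lam (hyp t)) (sphDecay lam) g t
      = ∫ s in Ioi 0, |sphGreenKernel lam t s| * sph lam' (hyp s) * Real.sinh (2 * s) * (-(g s / sph lam' (hyp s))) := by
    rw [greenSolI_eq_integral_kernel hB hA ht]
    apply setIntegral_congr_fun measurableSet_Ioi
    intro s _
    have hφ : sph lam' (hyp s) ≠ 0 := (sph_hyp_pos lam' s).ne'
    simp only
    rw [abs_of_neg (sphGreenKernel_neg hlam ht)]
    unfold sphGreenKernel
    field_simp
  have hmass := integral_abs_sphGreenKernel_mul_sph_snd hlam h1 h2 ht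
  have e2 : ∫ s in Ioi 0, |sphGreenKernel lam t s| * sph lam' (hyp s) * Real.sinh (2 * s) * (-(g s / sph lam' (hyp s))) ^ 2
      = ∫ s in Ioi 0, |sphGreenKernel lam t s| * Real.sinh (2 * s) * (g s ^ 2 / sph lam' (hyp s)) := by
    apply setIntegral_congr_fun measurableSet_Ioi
    intro s _
    have hφ : sph lam' (hyp s) ≠ 0 := (sph_hyp_pos lam' s).ne'
    simp only
    field_simp
  rw [hrep]
  rw [hmass, e2] at hcs
  exact hcs

include hlam h1 h2 hg hM hM0 hε hC hg2 in
/-- **The weighted Schur bound holds almost everywhere**: `sinh 2t · G^I_λ g(t)² ≤ (1/(μ − μ′)) ∫_s F(t, s) ds` for a.e.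
`t > 0`, where `F(t, s) = |K_λ(t, s)| (g(s)²/φ_{λ′}(s)) sinh 2s · φ_{λ′}(t) sinh 2t`. -/
theorem ae_sq_greenSolI_mul_sinh_le_weighted :
    ∀ᵐ t ∂(volume.restrict (Ioi 0)), Real.sinh (2 * t) * greenSolI (fun t => sph lam (hyp t)) (sphDecay lam) g t ^ 2
      ≤ (1 / (lam * (lam - 2) - lam' * (lam' - 2))) * ∫ s in Ioi 0, Function.uncurry (fun t s =>
        |sphGreenKernel lam t s| * (Real.sinh (2 * s) * g s ^ 2 / sph lam' (hyp s))
          * (sph lam' (hyp t) * Real.sinh (2 * t))) (t, s) := by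
  have hF := integrable_prod_kernel_sq_weighted hlam h1 h2 hg hg2
  have hsec := hF.prod_right_ae
  have hmem : ∀ᵐ t : ℝ ∂(volume.restrict (Ioi (0 : ℝ))), t ∈ Ioi 0 := ae_restrict_mem measurableSet_Ioi
  filter_upwards [hsec, hmem] with t hsec_t ht
  have ht0 : 0 < t := ht
  have hsinh : 0 < Real.sinh (2 * t) := Real.sinh_pos_iff.mpr (by linarith)
  have hφ : 0 < sph lam' (hyp t) := sph_hyp_pos lam' t
  -- the section at `t`, divided by `φ_{λ′}(t) sinh 2t`, is integrable
  have hI : IntegrableOn (fun s => |sphGreenKernel lam t s| * Real.sinh (2 * s) * (g s ^ 2 / sph lam' (hyp s)))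
      (Ioi 0) := by
    have h := hsec_t.const_mul (1 / (sph lam' (hyp t) * Real.sinh (2 * t)))
    refine h.congr (Eventually.of_forall fun s => ?_)
    simp only [Function.uncurry_apply_pair]
    field_simp
  have hcs := sq_greenSolI_le_weighted hlam h1 h2 hg hM hM0 hε hC ht0 hI
  have e : ∫ s in Ioi 0, Function.uncurry (fun t s => |sphGreenKernel lam t s|
      * (Real.sinh (2 * s) * g s ^ 2 / sph lam' (hyp s)) * (sph lam' (hyp t) * Real.sinh (2 * t))) (t, s)
      = (sph lam' (hyp t) * Real.sinh (2 * t))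
        * ∫ s in Ioi 0, |sphGreenKernel lam t s| * Real.sinh (2 * s) * (g s ^ 2 / sph lam' (hyp s)) := by
    rw [← MeasureTheory.integral_const_mul]
    apply setIntegral_congr_fun measurableSet_Ioi
    intro s _
    simp only [Function.uncurry_apply_pair]
    ring
  rw [e]
  calc Real.sinh (2 * t) * greenSolI (fun t => sph lam (hyp t)) (sphDecay lam) g t ^ 2
      ≤ Real.sinh (2 * t) * ((sph lam' (hyp t) / (lam * (lam - 2) - lam' * (lam' - 2)))
          * ∫ s in Ioi 0, |sphGreenKernel lam t s| * Real.sinh (2 * s) * (g s ^ 2 / sph lam' (hyp s))) :=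
        mul_le_mul_of_nonneg_left hcs hsinh.le
    _ = (1 / (lam * (lam - 2) - lam' * (lam' - 2))) * ((sph lam' (hyp t) * Real.sinh (2 * t))
          * ∫ s in Ioi 0, |sphGreenKernel lam t s| * Real.sinh (2 * s) * (g s ^ 2 / sph lam' (hyp s))) := by ring

include hlam h1 h2 hg hM hM0 hε hC hg2 in
/-- **THE RESOLVENT PRESERVES `L²(sinh 2t dt)` FOR EVERY `λ > 1`**: for a source `g` of the class with
`g² sinh 2s ∈ L¹(0, ∞)`, `sinh 2t · G^I_λ g(t)²` is integrable on `(0, ∞)`. -/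
theorem integrableOn_sinh_mul_greenSolI_sq_weighted :
    IntegrableOn (fun t => Real.sinh (2 * t) * greenSolI (fun t => sph lam (hyp t)) (sphDecay lam) g t ^ 2) (Ioi 0) := by
  have hF := integrable_prod_kernel_sq_weighted hlam h1 h2 hg hg2
  have hH := hF.integral_prod_left.const_mul (1 / (lam * (lam - 2) - lam' * (lam' - 2)))
  have hcont : ContinuousOn (fun t => Real.sinh (2 * t) * greenSolI (fun t => sph lam (hyp t)) (sphDecay lam) g t ^ 2)
      (Ioi 0) :=
    (Real.continuous_sinh.comp (continuous_const.mul continuous_id)).continuousOn.mul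
      ((continuousOn_greenSolI hlam hg hM hM0 hε hC).pow 2)
  refine Integrable.mono' hH (hcont.aestronglyMeasurable measurableSet_Ioi) ?_
  have hae := ae_sq_greenSolI_mul_sinh_le_weighted hlam h1 h2 hg hM hM0 hε hC hg2
  have hmem : ∀ᵐ t : ℝ ∂(volume.restrict (Ioi (0 : ℝ))), t ∈ Ioi 0 := ae_restrict_mem measurableSet_Ioi
  filter_upwards [hae, hmem] with t hle ht
  have ht0 : 0 < t := ht
  have hsinh : 0 ≤ Real.sinh (2 * t) := Real.sinh_nonneg_iff.mpr (by linarith)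
  rw [Real.norm_eq_abs, abs_of_nonneg (mul_nonneg hsinh (sq_nonneg _))]
  exact hle

include hlam h1 h2 hg hM hM0 hε hC hg2 in
/-- **THE WEIGHTED SCHUR BOUND**: `∫_{(0,∞)} sinh 2t (G^I_λ g)² ≤ (∫_{(0,∞)} sinh 2s g²)/(μ − μ′)²` for every `λ > 1`, every
`1 < λ′ < λ` and every square-integrable source of the class — the `L²(sinh 2t dt)` operator norm of `(L − μ)⁻¹` is at
most `1/(μ − μ′)`; as `λ′ → 1⁺` this tends to `1/(λ − 1)²`. -/
theorem integral_sinh_mul_greenSolI_sq_le_weighted :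
    ∫ t in Ioi 0, Real.sinh (2 * t) * greenSolI (fun t => sph lam (hyp t)) (sphDecay lam) g t ^ 2
      ≤ (∫ s in Ioi 0, Real.sinh (2 * s) * g s ^ 2) / (lam * (lam - 2) - lam' * (lam' - 2)) ^ 2 := by
  have hμ : 0 < lam * (lam - 2) - lam' * (lam' - 2) := by nlinarith
  have hF := integrable_prod_kernel_sq_weighted hlam h1 h2 hg hg2
  have hswap := integral_integral_swap hF
  -- the left-hand side is dominated by `1/(μ − μ′)` times the iterated integral
  have hleft : ∫ t in Ioi 0, Real.sinh (2 * t) * greenSolI (fun t => sph lam (hyp t)) (sphDecay lam) g t ^ 2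
      ≤ ∫ t in Ioi 0, (1 / (lam * (lam - 2) - lam' * (lam' - 2))) * ∫ s in Ioi 0, Function.uncurry (fun t s =>
        |sphGreenKernel lam t s| * (Real.sinh (2 * s) * g s ^ 2 / sph lam' (hyp s))
          * (sph lam' (hyp t) * Real.sinh (2 * t))) (t, s) :=
    integral_mono_ae (integrableOn_sinh_mul_greenSolI_sq_weighted hlam h1 h2 hg hM hM0 hε hC hg2)
      (hF.integral_prod_left.const_mul _) (ae_sq_greenSolI_mul_sinh_le_weighted hlam h1 h2 hg hM hM0 hε hC hg2)
  -- the swapped iterated integral is `∫_s g(s)² sinh 2s/(μ − μ′)`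
  have hright : ∫ s in Ioi 0, ∫ t in Ioi 0, |sphGreenKernel lam t s| * (Real.sinh (2 * s) * g s ^ 2 / sph lam' (hyp s))
        * (sph lam' (hyp t) * Real.sinh (2 * t))
      = (∫ s in Ioi 0, Real.sinh (2 * s) * g s ^ 2) / (lam * (lam - 2) - lam' * (lam' - 2)) := by
    rw [← MeasureTheory.integral_div]
    apply setIntegral_congr_fun measurableSet_Ioi
    intro s hs
    have hs0 : 0 < s := hs
    have hφ : sph lam' (hyp s) ≠ 0 := (sph_hyp_pos lam' s).ne'
    simp only
    have e : ∫ t in Ioi 0, |sphGreenKernel lam t s| * (Real.sinh (2 * s) * g s ^ 2 / sph lam' (hyp s))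
        * (sph lam' (hyp t) * Real.sinh (2 * t))
        = ∫ t in Ioi 0, |sphGreenKernel lam t s * sph lam' (hyp t) * Real.sinh (2 * t)|
          * (Real.sinh (2 * s) * g s ^ 2 / sph lam' (hyp s)) := by
      apply setIntegral_congr_fun measurableSet_Ioi
      intro t ht
      have ht0 : 0 < t := ht
      simp only
      rw [abs_mul, abs_mul, abs_of_pos (sph_hyp_pos lam' t),
        abs_of_nonneg (Real.sinh_nonneg_iff.mpr (by linarith : (0 : ℝ) ≤ 2 * t))]
      ring
    rw [e, MeasureTheory.integral_mul_const, integral_abs_kernel_mul_sph_fst hlam h1 h2 hs0]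
    field_simp
  have hswap' : ∫ t in Ioi 0, ∫ s in Ioi 0, Function.uncurry (fun t s => |sphGreenKernel lam t s|
        * (Real.sinh (2 * s) * g s ^ 2 / sph lam' (hyp s)) * (sph lam' (hyp t) * Real.sinh (2 * t))) (t, s)
      = ∫ s in Ioi 0, ∫ t in Ioi 0, |sphGreenKernel lam t s| * (Real.sinh (2 * s) * g s ^ 2 / sph lam' (hyp s))
        * (sph lam' (hyp t) * Real.sinh (2 * t)) := by
    simpa only [Function.uncurry_apply_pair] using hswap
  calc ∫ t in Ioi 0, Real.sinh (2 * t) * greenSolI (fun t => sph lam (hyp t)) (sphDecay lam) g t ^ 2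
      ≤ ∫ t in Ioi 0, (1 / (lam * (lam - 2) - lam' * (lam' - 2))) * ∫ s in Ioi 0, Function.uncurry (fun t s =>
          |sphGreenKernel lam t s| * (Real.sinh (2 * s) * g s ^ 2 / sph lam' (hyp s))
            * (sph lam' (hyp t) * Real.sinh (2 * t))) (t, s) := hleft
    _ = (1 / (lam * (lam - 2) - lam' * (lam' - 2))) * ∫ t in Ioi 0, ∫ s in Ioi 0, Function.uncurry (fun t s =>
          |sphGreenKernel lam t s| * (Real.sinh (2 * s) * g s ^ 2 / sph lam' (hyp s))
            * (sph lam' (hyp t) * Real.sinh (2 * t))) (t, s) := MeasureTheory.integral_const_mul _ _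
    _ = (1 / (lam * (lam - 2) - lam' * (lam' - 2)))
          * ((∫ s in Ioi 0, Real.sinh (2 * s) * g s ^ 2) / (lam * (lam - 2) - lam' * (lam' - 2))) := by
          rw [hswap', hright]
    _ = (∫ s in Ioi 0, Real.sinh (2 * s) * g s ^ 2) / (lam * (lam - 2) - lam' * (lam' - 2)) ^ 2 := by
          rw [one_div, ← div_eq_inv_mul, div_div, ← pow_two]

end measure

end Summit.Ventures.HodgeRepro2.T5SU11ResolventL2SchurWeighted
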